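import Summits.NavierStokesRegularity.NavierStokesRegularity.Theorems.ExtremiserTransienceNearExtremalTransienceExtremiserLiouvilleConstantSpeedKKTTailTools
import HarnessLib

/-!
# Crux `ExtremiserTransience.NearExtremalTransience` (stmt-NavierStokesRegularity-21883), line `extremiser_liouville`,
# stub K1b — THE KKT TAIL CONDITION: a multiplier-free first-order constraint at the `|x|⁻¹` scale

`--supports stmt-NavierStokesRegularity-21883` (helper).  Author: prover seat `ns-el-k1b` (g4).

For the K1b residue object `v` (smooth, divergence free, constant speed `‖v‖ ≡ M > 0`, bounded gradient, `D¹v, D²v ∈ L²`,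
extremal `|S| = κ⋆ M √Z √W` with `M√Z√W > 0`) with far field `c` (`v → c` at infinity), and for ANY smooth compactly
supported divergence-free profile `Φ` vanishing near the origin with `⟪c, Φ(y)⟫ = 0` for all `y`
(`residue_tail_pairing_tendsto_zero`):

  **`a₁(φ_R) = ∫⟪curl v, curl φ_R⟫ → 0` as `R → ∞`, where `φ_R(x) = Φ(x/R)`.**

Since `curl φ_R = R⁻¹(curl Φ)(x/R)`, this says `R⁻¹∫⟪ω(x), (curl Φ)(x/R)⟫dx → 0`: in the exact-`|x|⁻¹` regime singled out
by the decay-gap Liouville (`…ConstantSpeedDecayLiouville{,General}`) — where `R²ω(R·)` is bounded in `L²_loc` and the pairing is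
generically `O(1)` — every weak tail limit `Ω_∞` of the rescaled vorticity satisfies `∫⟪Ω_∞, curl Φ⟫ = 0` for all `c`-horizontal
solenoidal `Φ`, i.e. the record's far-field condition (C) (leading twist harmonic / dipole) obtained from FIRST-ORDER KKT alone, with
no multiplier measure.  The explicit non-extremal example `…ConstantSpeedExample` violates it, as it must.

MECHANISM (`kkt_twoSided` + scaling).  The tree's KKT inequality `ext_firstVariation_le_of_sup_inner` (p641635) applied to `φ_R` and
to `−φ_R` with the common slope `s_R = ‖Φ‖_∞ · sup_{|x| ≥ r₀R}‖v − c‖ → 0` (here `⟪c, Φ⟫ = 0` is used) squeezes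
`κ⋆²M²W·a₁(φ_R)` between `±(κ⋆²ZW s_R + |S||J₁(φ_R)| + κ⋆²M²Z|c₁(φ_R)|)`; by GLOBAL `L²` bounds only, `|J₁(φ_R)| ≤ C(‖Dv‖₂² +
2‖ω‖₂²)/R` and `|c₁(φ_R)| ≤ (η/2)W + 3C²r₁³|B₁|/(2ηR)` for every `η > 0` (Young + the volume of the support of `φ_R`).

WHAT THIS IS NOT: K1b is NOT proved; nothing here proves NS regularity. [folklore]
-/

noncomputable section

open Set Filter Topology MeasureTheory Metric Function
open scoped ENNReal NNReal Topology InnerProductSpace RealInnerProductSpace ContDiff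
open Literature.Analysis.FluidPDE Literature.Analysis

namespace Summit.NavierStokesRegularity.NavierStokesRegularity.Theorems

-- the problem directory repeats the summit name (`NavierStokesRegularity/NavierStokesRegularity`)
set_option linter.dupNamespace false

namespace ExtremiserLiouville

variable {v φ : EuclideanSpace ℝ (Fin 3) → EuclideanSpace ℝ (Fin 3)} {c : EuclideanSpace ℝ (Fin 3)}

/-- Negating a test field negates `curl`, `D`, `D curl` (pointwise identities used for the two-sided KKT). [folklore] -/
theorem neg_testField_identities (φ : EuclideanSpace ℝ (Fin 3) → EuclideanSpace ℝ (Fin 3)) :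
    (curl fun y => -φ y) = (fun x => -curl φ x) ∧ (fderiv ℝ fun y => -φ y) = (fun x => -fderiv ℝ φ x) ∧
      (fderiv ℝ (curl fun y => -φ y)) = fun x => -fderiv ℝ (curl φ) x := by
  have h1 : (curl fun y => -φ y) = (fun x => -curl φ x) := funext fun x => curl_neg φ x
  refine ⟨h1, funext fun x => fderiv_fun_neg, ?_⟩
  rw [h1]; funext x; exact fderiv_fun_neg

/-- **Two-sided KKT.**  For the residue object and a test field `φ` (smooth, compactly supported, divergence free) with
`|⟪v x, φ x⟫| ≤ s` for all `x`:
`κ⋆²M²W·|a₁(φ)| ≤ κ⋆²ZW·s + |S|·|J₁(φ)| + κ⋆²M²Z·|c₁(φ)|`. [folklore] -/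
theorem kkt_twoSided
    (hv : ContDiff ℝ ∞ v) (hdiv : VectorCalculus.IsDivFree v) {M B : ℝ} (hMpos : 0 < M)
    (hM : ∀ x, ‖v x‖ = M) (hB : ∀ x, ‖fderiv ℝ v x‖ ≤ B)
    (h1 : ∫⁻ x, ‖iteratedFDeriv ℝ 1 v x‖ₑ ^ 2 < ⊤) (h2 : ∫⁻ x, ‖iteratedFDeriv ℝ 2 v x‖ₑ ^ 2 < ⊤)
    (hatt : |∫ x, ⟪curl v x, fderiv ℝ v x (curl v x)⟫| = (sInf {κ : ℝ | (∀ (v : EuclideanSpace ℝ (Fin 3) → EuclideanSpace ℝ (Fin 3)) (M B : ℝ), ContDiff ℝ (⊤ : ℕ∞) v → Literature.Analysis.FluidPDE.VectorCalculus.IsDivFree v → (∀ x, ‖v x‖ ≤ M) → (∀ x, ‖fderiv ℝ v x‖ ≤ B) → (∫⁻ x, ‖iteratedFDeriv ℝ 0 v x‖ₑ ^ 2 < ⊤) → (∫⁻ x, ‖iteratedFDeriv ℝ 1 v x‖ₑ ^ 2 < ⊤) → (∫⁻ x, ‖iteratedFDeriv ℝ 2 v x‖ₑ ^ 2 < ⊤)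 → |∫ x, ⟪Literature.Analysis.FluidPDE.curl v x, fderiv ℝ v x (Literature.Analysis.FluidPDE.curl v x)⟫_ℝ| ≤ κ * M * Real.sqrt (∫ x, ‖Literature.Analysis.FluidPDE.curl v x‖ ^ 2) * Real.sqrt (∫ x, Literature.Analysis.FluidPDE.frobeniusNormSq (fderiv ℝ (Literature.Analysis.FluidPDE.curl v) x)))}) * M * Real.sqrt (∫ x, ‖curl v x‖ ^ 2) * Real.sqrt (∫ x, frobeniusNormSq (fderiv ℝ (curl v) x)))
    (hφ : ContDiff ℝ ∞ φ) (hφc : HasCompactSupport φ) (hφdiv : VectorCalculus.IsDivFree φ)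
    {s : ℝ} (hs : ∀ x, |⟪v x, φ x⟫| ≤ s) :
    (sInf {κ : ℝ | (∀ (v : EuclideanSpace ℝ (Fin 3) → EuclideanSpace ℝ (Fin 3)) (M B : ℝ), ContDiff ℝ (⊤ : ℕ∞) v → Literature.Analysis.FluidPDE.VectorCalculus.IsDivFree v → (∀ x, ‖v x‖ ≤ M) → (∀ x, ‖fderiv ℝ v x‖ ≤ B) → (∫⁻ x, ‖iteratedFDeriv ℝ 0 v x‖ₑ ^ 2 < ⊤) → (∫⁻ x, ‖iteratedFDeriv ℝ 1 v x‖ₑ ^ 2 < ⊤) → (∫⁻ x, ‖iteratedFDeriv ℝ 2 v x‖ₑ ^ 2 < ⊤) → |∫ x, ⟪Literature.Analysis.FluidPDE.curl v x, fderiv ℝ v x (Literature.Analysis.FluidPDE.curl v x)⟫_ℝ| ≤ κ * M * Real.sqrt (∫ x, ‖Literature.Analysis.FluidPDE.curl v x‖ ^ 2) * Real.sqrt (∫ x, Literature.Analysis.FluidPDE.frobeniusNormSq (fderiv ℝ (Literature.Analysis.FluidPDE.curl v) x)))}) ^ 2 * M ^ 2 *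
        (∫ x, frobeniusNormSq (fderiv ℝ (curl v) x)) * |∫ x, ⟪curl v x, curl φ x⟫| ≤
      (sInf {κ : ℝ | (∀ (v : EuclideanSpace ℝ (Fin 3) → EuclideanSpace ℝ (Fin 3)) (M B : ℝ), ContDiff ℝ (⊤ : ℕ∞) v → Literature.Analysis.FluidPDE.VectorCalculus.IsDivFree v → (∀ x, ‖v x‖ ≤ M) → (∀ x, ‖fderiv ℝ v x‖ ≤ B) → (∫⁻ x, ‖iteratedFDeriv ℝ 0 v x‖ₑ ^ 2 < ⊤) → (∫⁻ x, ‖iteratedFDeriv ℝ 1 v x‖ₑ ^ 2 < ⊤) → (∫⁻ x, ‖iteratedFDeriv ℝ 2 v x‖ₑ ^ 2 < ⊤) → |∫ x, ⟪Literature.Analysis.FluidPDE.curl v x, fderiv ℝ v x (Literature.Analysis.FluidPDE.curl v x)⟫_ℝ| ≤ κ * M * Real.sqrt (∫ x, ‖Literature.Analysis.FluidPDE.curl v x‖ ^ 2) * Real.sqrt (∫ x, Literature.Analysis.FluidPDE.frobeniusNormSq (fderiv ℝ (Literature.Analysis.FluidPDE.curl v) x)))}) ^ 2 *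
          (∫ x, ‖curl v x‖ ^ 2) * (∫ x, frobeniusNormSq (fderiv ℝ (curl v) x)) * s +
        |∫ x, ⟪curl v x, fderiv ℝ v x (curl v x)⟫| *
          |∫ x, (⟪curl φ x, fderiv ℝ v x (curl v x)⟫ + ⟪curl v x, fderiv ℝ φ x (curl v x)⟫ + ⟪curl v x, fderiv ℝ v x (curl φ x)⟫)| +
        (sInf {κ : ℝ | (∀ (v : EuclideanSpace ℝ (Fin 3) → EuclideanSpace ℝ (Fin 3)) (M B : ℝ), ContDiff ℝ (⊤ : ℕ∞) v → Literature.Analysis.FluidPDE.VectorCalculus.IsDivFree v → (∀ x, ‖v x‖ ≤ M) → (∀ x, ‖fderiv ℝ v x‖ ≤ B) → (∫⁻ x, ‖iteratedFDeriv ℝ 0 v x‖ₑ ^ 2 < ⊤) → (∫⁻ x, ‖iteratedFDeriv ℝ 1 v x‖ₑ ^ 2 < ⊤) → (∫⁻ x, ‖iteratedFDeriv ℝ 2 v x‖ₑ ^ 2 < ⊤) → |∫ x, ⟪Literature.Analysis.FluidPDE.curl v x, fderiv ℝ v x (Literature.Analysis.FluidPDE.curl v x)⟫_ℝ| ≤ κ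 * M * Real.sqrt (∫ x, ‖Literature.Analysis.FluidPDE.curl v x‖ ^ 2) * Real.sqrt (∫ x, Literature.Analysis.FluidPDE.frobeniusNormSq (fderiv ℝ (Literature.Analysis.FluidPDE.curl v) x)))}) ^ 2 * M ^ 2 *
          (∫ x, ‖curl v x‖ ^ 2) * |∫ x, ∑ i, ⟪fderiv ℝ (curl v) x (EuclideanSpace.basisFun (Fin 3) ℝ i), fderiv ℝ (curl φ) x (EuclideanSpace.basisFun (Fin 3) ℝ i)⟫| := by
  set K : ℝ := (sInf {κ : ℝ | (∀ (v : EuclideanSpace ℝ (Fin 3) → EuclideanSpace ℝ (Fin 3)) (M B : ℝ), ContDiff ℝ (⊤ : ℕ∞) v → Literature.Analysis.FluidPDE.VectorCalculus.IsDivFree v → (∀ x, ‖v x‖ ≤ M) → (∀ x, ‖fderiv ℝ v x‖ ≤ B) → (∫⁻ x, ‖iteratedFDeriv ℝ 0 v x‖ₑ ^ 2 < ⊤) → (∫⁻ x, ‖iteratedFDeriv ℝ 1 v x‖ₑ ^ 2 < ⊤) → (∫⁻ x, ‖iteratedFDeriv ℝ 2 v x‖ₑ ^ 2 < ⊤) →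 |∫ x, ⟪Literature.Analysis.FluidPDE.curl v x, fderiv ℝ v x (Literature.Analysis.FluidPDE.curl v x)⟫_ℝ| ≤ κ * M * Real.sqrt (∫ x, ‖Literature.Analysis.FluidPDE.curl v x‖ ^ 2) * Real.sqrt (∫ x, Literature.Analysis.FluidPDE.frobeniusNormSq (fderiv ℝ (Literature.Analysis.FluidPDE.curl v) x)))}) with hK
  set Z : ℝ := ∫ x, ‖curl v x‖ ^ 2 with hZ
  set W : ℝ := ∫ x, frobeniusNormSq (fderiv ℝ (curl v) x) with hW
  set S : ℝ := ∫ x, ⟪curl v x, fderiv ℝ v x (curl v x)⟫ with hS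
  set J : ℝ := ∫ x, (⟪curl φ x, fderiv ℝ v x (curl v x)⟫ + ⟪curl v x, fderiv ℝ φ x (curl v x)⟫ + ⟪curl v x, fderiv ℝ v x (curl φ x)⟫) with hJ
  set A : ℝ := ∫ x, ⟪curl v x, curl φ x⟫ with hA
  set C : ℝ := ∫ x, ∑ i, ⟪fderiv ℝ (curl v) x (EuclideanSpace.basisFun (Fin 3) ℝ i), fderiv ℝ (curl φ) x (EuclideanSpace.basisFun (Fin 3) ℝ i)⟫ with hC
  have hZ0 : 0 ≤ Z := integral_nonneg fun x => sq_nonneg _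
  have hW0 : 0 ≤ W := integral_nonneg fun x => frobeniusNormSq_nonneg _
  -- KKT for `φ`
  have hplus := ext_firstVariation_le_of_sup_inner hv hdiv hMpos hM hB h1 h2 hatt hφ hφc hφdiv
    (s := s) (fun x => (le_abs_self _).trans (hs x))
  -- KKT for `−φ`
  obtain ⟨ncurl, nD, nDcurl⟩ := neg_testField_identities φ
  have hminus := ext_firstVariation_le_of_sup_inner hv hdiv hMpos hM hB h1 h2 hatt hφ.neg hφc.neg
    (fun x => by
      have h := hφdiv x
      simp only [VectorCalculus.divergence] at h ⊢
      rw [fderiv_fun_neg, ContinuousLinearMap.toLinearMap_neg, map_neg, h, neg_zero])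
    (s := s) (fun x => by rw [inner_neg_right]; exact (neg_le_abs _).trans (hs x))
  have hJn : (∫ x, (⟪curl (fun y => -φ y) x, fderiv ℝ v x (curl v x)⟫ + ⟪curl v x, fderiv ℝ (fun y => -φ y) x (curl v x)⟫ +
      ⟪curl v x, fderiv ℝ v x (curl (fun y => -φ y) x)⟫)) = -J := by
    rw [ncurl, nD, hJ, ← integral_neg]
    refine integral_congr_ae (Eventually.of_forall fun x => ?_)
    simp only [inner_neg_left, inner_neg_right, neg_apply, map_neg]
    ring
  have hAn : (∫ x, ⟪curl v x, curl (fun y => -φ y) x⟫) = -A := by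
    rw [ncurl, hA, ← integral_neg]
    exact integral_congr_ae (Eventually.of_forall fun x => by simp only [inner_neg_right])
  have hCn : (∫ x, ∑ i, ⟪fderiv ℝ (curl v) x (EuclideanSpace.basisFun (Fin 3) ℝ i),
      fderiv ℝ (curl fun y => -φ y) x (EuclideanSpace.basisFun (Fin 3) ℝ i)⟫) = -C := by
    rw [nDcurl, hC, ← integral_neg]
    refine integral_congr_ae (Eventually.of_forall fun x => ?_)
    simp only [neg_apply, inner_neg_right, Finset.sum_neg_distrib]
  rw [hJn, hAn, hCn] at hminus
  -- combine (everything linear in the atoms `S*J`, `|S|*|J|`, `K²M²W A`, `K²M²Z C`, `K²M²Z|C|`, `K²ZW s`)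
  have hM0 : M ≠ 0 := hMpos.ne'
  have hKMZ : 0 ≤ K ^ 2 * M ^ 2 * Z := by positivity
  have e1 : K ^ 2 * M ^ 2 * (s / M ^ 2 * Z * W + W * A + Z * C) =
      K ^ 2 * Z * W * s + K ^ 2 * M ^ 2 * W * A + K ^ 2 * M ^ 2 * Z * C := by field_simp
  have e2 : K ^ 2 * M ^ 2 * (s / M ^ 2 * Z * W + W * -A + Z * -C) =
      K ^ 2 * Z * W * s - K ^ 2 * M ^ 2 * W * A - K ^ 2 * M ^ 2 * Z * C := by field_simp; ring
  have eSJ : S * -J = -(S * J) := by ring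
  rw [e1] at hplus
  rw [e2, eSJ] at hminus
  have f1 : S * J ≤ |S| * |J| := by rw [← abs_mul]; exact le_abs_self _
  have f2 : -(|S| * |J|) ≤ S * J := by rw [← abs_mul]; exact neg_abs_le _
  have f3 : K ^ 2 * M ^ 2 * Z * C ≤ K ^ 2 * M ^ 2 * Z * |C| := mul_le_mul_of_nonneg_left (le_abs_self C) hKMZ
  have f4 : -(K ^ 2 * M ^ 2 * Z * |C|) ≤ K ^ 2 * M ^ 2 * Z * C := by
    have := mul_le_mul_of_nonneg_left (neg_le_abs C) hKMZ
    linarith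
  have hup : K ^ 2 * M ^ 2 * W * A ≤ K ^ 2 * Z * W * s + |S| * |J| + K ^ 2 * M ^ 2 * Z * |C| := by linarith
  have hlo : -(K ^ 2 * Z * W * s + |S| * |J| + K ^ 2 * M ^ 2 * Z * |C|) ≤ K ^ 2 * M ^ 2 * W * A := by linarith
  have hfac : 0 ≤ K ^ 2 * M ^ 2 * W := by positivity
  have eabs : K ^ 2 * M ^ 2 * W * |A| = |K ^ 2 * M ^ 2 * W * A| := by rw [abs_mul, abs_of_nonneg hfac]
  rw [eabs]
  exact abs_le.2 ⟨hlo, hup⟩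


/-- **THE KKT TAIL CONDITION.**  For the K1b residue object `v` (constant speed `M > 0`, extremal, `M√Z√W > 0`) with far
field `c`, and any smooth compactly supported divergence-free profile `Φ` vanishing on `B(0,r₀)` with `⟪c, Φ⟫ ≡ 0`:
`a₁(φ_R) = ∫⟪curl v, curl φ_R⟫ → 0` as `R → ∞` (`φ_R = Φ(·/R)`; recall `curl φ_R = R⁻¹(curl Φ)(·/R)`). [folklore] -/
theorem residue_tail_pairing_tendsto_zero {Φ : EuclideanSpace ℝ (Fin 3) → EuclideanSpace ℝ (Fin 3)}
    (hv : ContDiff ℝ ∞ v) (hdiv : VectorCalculus.IsDivFree v) {M B : ℝ} (hMpos : 0 < M)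
    (hM : ∀ x, ‖v x‖ = M) (hB : ∀ x, ‖fderiv ℝ v x‖ ≤ B)
    (h1 : ∫⁻ x, ‖iteratedFDeriv ℝ 1 v x‖ₑ ^ 2 < ⊤) (h2 : ∫⁻ x, ‖iteratedFDeriv ℝ 2 v x‖ₑ ^ 2 < ⊤)
    (hpos : 0 < M * Real.sqrt (∫ x, ‖curl v x‖ ^ 2) * Real.sqrt (∫ x, frobeniusNormSq (fderiv ℝ (curl v) x)))
    (hatt : |∫ x, ⟪curl v x, fderiv ℝ v x (curl v x)⟫| = (sInf {κ : ℝ | (∀ (v : EuclideanSpace ℝ (Fin 3) → EuclideanSpace ℝ (Fin 3)) (M B : ℝ), ContDiff ℝ (⊤ : ℕ∞) v → Literature.Analysis.FluidPDE.VectorCalculus.IsDivFree v → (∀ x, ‖v x‖ ≤ M) → (∀ x, ‖fderiv ℝ v x‖ ≤ B) → (∫⁻ x, ‖iteratedFDeriv ℝ 0 v x‖ₑ ^ 2 < ⊤) → (∫⁻ x, ‖iteratedFDeriv ℝ 1 v x‖ₑ ^ 2 < ⊤) → (∫⁻ x, ‖iteratedFDeriv ℝ 2 v x‖ₑ ^ 2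 < ⊤) → |∫ x, ⟪Literature.Analysis.FluidPDE.curl v x, fderiv ℝ v x (Literature.Analysis.FluidPDE.curl v x)⟫_ℝ| ≤ κ * M * Real.sqrt (∫ x, ‖Literature.Analysis.FluidPDE.curl v x‖ ^ 2) * Real.sqrt (∫ x, Literature.Analysis.FluidPDE.frobeniusNormSq (fderiv ℝ (Literature.Analysis.FluidPDE.curl v) x)))}) * M * Real.sqrt (∫ x, ‖curl v x‖ ^ 2) * Real.sqrt (∫ x, frobeniusNormSq (fderiv ℝ (curl v) x)))
    (hfar : Tendsto (fun x => v x - c) (cocompact (EuclideanSpace ℝ (Fin 3))) (𝓝 0))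
    (hΦ : ContDiff ℝ ∞ Φ) (hΦc : HasCompactSupport Φ) (hΦdiv : VectorCalculus.IsDivFree Φ) {r₀ : ℝ} (hr₀ : 0 < r₀)
    (hΦ0 : ∀ y, ‖y‖ < r₀ → Φ y = 0) (hcΦ : ∀ y, ⟪c, Φ y⟫ = 0) :
    Tendsto (fun R : ℝ => ∫ x, ⟪curl v x, curl (fun y => Φ (R⁻¹ • y)) x⟫) atTop (𝓝 0) := by
  set K : ℝ := (sInf {κ : ℝ | (∀ (v : EuclideanSpace ℝ (Fin 3) → EuclideanSpace ℝ (Fin 3)) (M B : ℝ), ContDiff ℝ (⊤ : ℕ∞) v → Literature.Analysis.FluidPDE.VectorCalculus.IsDivFree v → (∀ x, ‖v x‖ ≤ M) → (∀ x, ‖fderiv ℝ v x‖ ≤ B) → (∫⁻ x, ‖iteratedFDeriv ℝ 0 v x‖ₑ ^ 2 < ⊤) → (∫⁻ x, ‖iteratedFDeriv ℝ 1 v x‖ₑ ^ 2 < ⊤) → (∫⁻ x, ‖iteratedFDeriv ℝ 2 v x‖ₑ ^ 2 < ⊤) → |∫ x, ⟪Literature.Analysis.FluidPDE.curl v x, fderiv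 ℝ v x (Literature.Analysis.FluidPDE.curl v x)⟫_ℝ| ≤ κ * M * Real.sqrt (∫ x, ‖Literature.Analysis.FluidPDE.curl v x‖ ^ 2) * Real.sqrt (∫ x, Literature.Analysis.FluidPDE.frobeniusNormSq (fderiv ℝ (Literature.Analysis.FluidPDE.curl v) x)))}) with hK
  set Z : ℝ := ∫ x, ‖curl v x‖ ^ 2 with hZ
  set W : ℝ := ∫ x, frobeniusNormSq (fderiv ℝ (curl v) x) with hW
  set S : ℝ := ∫ x, ⟪curl v x, fderiv ℝ v x (curl v x)⟫ with hS
  have hKpos : 0 < K := lt_trans (by norm_num) DepletionLadder.sharpDepletion_gt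
  have hZ0 : 0 ≤ Z := integral_nonneg fun x => sq_nonneg _
  have hW0 : 0 ≤ W := integral_nonneg fun x => frobeniusNormSq_nonneg _
  -- `Z, W > 0` and integrability of the densities (from `hpos`: a Bochner integral of a non-integrable function is `0`)
  have hZpos : 0 < Z := by
    by_contra h
    have hZe : Z = 0 := le_antisymm (not_lt.1 h) hZ0
    rw [hZe, Real.sqrt_zero, mul_zero, zero_mul] at hpos
    exact lt_irrefl _ hpos
  have hWpos : 0 < W := by
    by_contra h
    have hWe : W = 0 := le_antisymm (not_lt.1 h) hW0
    rw [hWe, Real.sqrt_zero, mul_zero] at hpos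
    exact lt_irrefl _ hpos
  have IZ : Integrable (fun x => ‖curl v x‖ ^ 2) volume := by
    by_contra h; exact hZpos.ne' (integral_undef h)
  have IW : Integrable (fun x => frobeniusNormSq (fderiv ℝ (curl v) x)) volume := by
    by_contra h; exact hWpos.ne' (integral_undef h)
  have ID : Integrable (fun x => ‖fderiv ℝ v x‖ ^ 2) volume := by
    have h1' : ∫⁻ x, ‖fderiv ℝ v x‖ₑ ^ 2 < ⊤ := by
      refine lt_of_le_of_lt (le_of_eq (lintegral_congr fun x => ?_)) h1
      rw [← ofReal_norm, ← ofReal_norm, norm_iteratedFDeriv_one]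
    exact integrable_sq_norm_of_lintegral_lt_top (hv.continuous_fderiv (by simp)) h1'
  -- profile constants
  obtain ⟨CΦ, hC0, hΦb, hcurlb, hDb, hDcurlb⟩ := exists_bounds_of_profile (hΦ.of_le (by norm_cast)) hΦc
  have hDcurlc : HasCompactSupport (fderiv ℝ (curl Φ)) := by
    have hD : HasCompactSupport (fderiv ℝ Φ) := hΦc.fderiv (𝕜 := ℝ)
    have hcurl : HasCompactSupport (curl Φ) := by
      rw [curl_eq_curlCLM_comp]; exact hD.comp_left (map_zero _)
    exact hcurl.fderiv (𝕜 := ℝ)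
  obtain ⟨r, hr⟩ := (Metric.isBounded_iff_subset_closedBall (0 : EuclideanSpace ℝ (Fin 3))).1 hDcurlc.isBounded
  set r₁ : ℝ := max r 1 with hr₁
  have hr₁pos : 0 < r₁ := lt_of_lt_of_le one_pos (le_max_right _ _)
  have hsupp : tsupport (fderiv ℝ (curl Φ)) ⊆ closedBall 0 r₁ := hr.trans (closedBall_subset_closedBall (le_max_left _ _))
  set v₁ : ℝ := (volume (ball (0 : EuclideanSpace ℝ (Fin 3)) 1)).toReal with hv₁
  have hv₁0 : 0 ≤ v₁ := ENNReal.toReal_nonneg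
  -- the majorant of the `J₁` density
  set g : EuclideanSpace ℝ (Fin 3) → ℝ := fun x => CΦ * (‖fderiv ℝ v x‖ ^ 2 + 2 * ‖curl v x‖ ^ 2) with hg
  have hgi : Integrable g volume := (ID.add (IZ.const_mul 2)).const_mul CΦ
  set G : ℝ := ∫ x, g x with hG
  have hG0 : 0 ≤ G := integral_nonneg fun x => by positivity
  have hΦd : Differentiable ℝ Φ := hΦ.differentiable (by simp)
  have hΦ2 : ContDiff ℝ 2 Φ := hΦ.of_le (by norm_cast)
  -- ε-management
  set D₀ : ℝ := K ^ 2 * M ^ 2 * W with hD₀def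
  have hD₀ : 0 < D₀ := by positivity
  rw [Metric.tendsto_atTop]
  intro ε hε
  set η : ℝ := ε * D₀ / (4 * (K ^ 2 * M ^ 2 * Z * W + 1)) with hηdef
  have hη : 0 < η := by positivity
  set δ : ℝ := ε * D₀ / (4 * (K ^ 2 * Z * W * CΦ + 1)) with hδdef
  have hδ : 0 < δ := by positivity
  -- far field: `‖v x − c‖ ≤ δ` for `‖x‖ ≥ ρ₀`
  obtain ⟨ρ₀, hρ₀⟩ : ∃ ρ₀ : ℝ, ∀ x : EuclideanSpace ℝ (Fin 3), ρ₀ ≤ ‖x‖ → ‖v x - c‖ ≤ δ := by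
    have h : (fun x => v x - c) ⁻¹' Metric.ball (0 : EuclideanSpace ℝ (Fin 3)) δ ∈ cocompact (EuclideanSpace ℝ (Fin 3)) :=
      hfar (Metric.ball_mem_nhds (0 : EuclideanSpace ℝ (Fin 3)) hδ)
    rw [mem_cocompact] at h
    obtain ⟨Kc, hKc, hKsub⟩ := h
    obtain ⟨ρ, hρ⟩ := (Metric.isBounded_iff_subset_closedBall (0 : EuclideanSpace ℝ (Fin 3))).1 hKc.isBounded
    refine ⟨ρ + 1, fun x hx => ?_⟩
    have hxK : x ∉ Kc := fun hmem => by
      have := hρ hmem; rw [mem_closedBall, dist_zero_right] at this; linarith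
    have := hKsub hxK
    rw [mem_preimage, Metric.mem_ball, dist_zero_right] at this
    exact this.le
  set T : ℝ := |S| * G + K ^ 2 * M ^ 2 * Z * (3 * CΦ ^ 2 * r₁ ^ 3 * v₁ / (2 * η)) with hT
  have hT0 : 0 ≤ T := by positivity
  refine ⟨max (max (ρ₀ / r₀) 1) (4 * T / (ε * D₀) + 1), fun R hR => ?_⟩
  have hR1 : 1 ≤ R := (le_max_right _ _).trans ((le_max_left _ _).trans hR)
  have hRpos : 0 < R := lt_of_lt_of_le one_pos hR1
  have hRρ : ρ₀ ≤ R * r₀ := by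
    have : ρ₀ / r₀ ≤ R := (le_max_left _ _).trans ((le_max_left _ _).trans hR)
    rwa [div_le_iff₀ hr₀] at this
  have hRT : 4 * T / (ε * D₀) ≤ R := by linarith [(le_max_right _ _).trans hR]
  have hRinv : 0 < R⁻¹ := inv_pos.2 hRpos
  -- the test field `φ_R`
  set φ : EuclideanSpace ℝ (Fin 3) → EuclideanSpace ℝ (Fin 3) := fun y => Φ (R⁻¹ • y) with hφdef
  have hφ : ContDiff ℝ ∞ φ := contDiff_rescale hΦ R
  have hφc : HasCompactSupport φ := hasCompactSupport_rescale hΦc hRpos.ne'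
  have hφdiv : VectorCalculus.IsDivFree φ := isDivFree_rescale hΦd hΦdiv R
  -- the slope `s = δ CΦ`
  have hs : ∀ x, |⟪v x, φ x⟫| ≤ δ * CΦ := by
    intro x
    by_cases hx : ‖R⁻¹ • x‖ < r₀
    · have : φ x = 0 := hΦ0 _ hx
      rw [this, inner_zero_right, abs_zero]; positivity
    · have hxn : ρ₀ ≤ ‖x‖ := by
        rw [not_lt, norm_smul, Real.norm_eq_abs, abs_of_pos hRinv] at hx
        have : R * r₀ ≤ ‖x‖ := by
          have := mul_le_mul_of_nonneg_left hx hRpos.le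
          rwa [← mul_assoc, mul_inv_cancel₀ hRpos.ne', one_mul] at this
        exact hRρ.trans this
      have e : ⟪v x, φ x⟫ = ⟪v x - c, φ x⟫ := by
        rw [inner_sub_left, hφdef]; simp only; rw [hcΦ, sub_zero]
      rw [e]
      exact (abs_real_inner_le_norm _ _).trans (mul_le_mul (hρ₀ x hxn) (hΦb _) (norm_nonneg _) hδ.le)
  -- two-sided KKT, folded into the local names
  have hkkt := kkt_twoSided hv hdiv hMpos hM hB h1 h2 hatt hφ hφc hφdiv hs
  rw [← hK, ← hZ, ← hW, ← hS, ← hD₀def] at hkkt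
  set Aφ : ℝ := ∫ x, ⟪curl v x, curl φ x⟫ with hAφ
  set Jφ : ℝ := ∫ x, (⟪curl φ x, fderiv ℝ v x (curl v x)⟫ + ⟪curl v x, fderiv ℝ φ x (curl v x)⟫ +
      ⟪curl v x, fderiv ℝ v x (curl φ x)⟫) with hJφ
  set Cφ : ℝ := ∫ x, ∑ i, ⟪fderiv ℝ (curl v) x (EuclideanSpace.basisFun (Fin 3) ℝ i),
      fderiv ℝ (curl φ) x (EuclideanSpace.basisFun (Fin 3) ℝ i)⟫ with hCφ
  -- bound on `J₁(φ_R)`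
  have hJ : |Jφ| ≤ G / R := by
    rw [hJφ]
    have hptw : ∀ x, |⟪curl φ x, fderiv ℝ v x (curl v x)⟫ + ⟪curl v x, fderiv ℝ φ x (curl v x)⟫ +
        ⟪curl v x, fderiv ℝ v x (curl φ x)⟫| ≤ g x / R := by
      intro x
      have hcφ : ‖curl φ x‖ ≤ R⁻¹ * CΦ := by
        rw [hφdef, curl_rescale hΦd, norm_smul, Real.norm_eq_abs, abs_of_pos hRinv]
        exact mul_le_mul_of_nonneg_left (hcurlb _) hRinv.le
      have hDφ : ‖fderiv ℝ φ x‖ ≤ R⁻¹ * CΦ := by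
        rw [hφdef, fderiv_rescale hΦd, norm_smul, Real.norm_eq_abs, abs_of_pos hRinv]
        exact mul_le_mul_of_nonneg_left (hDb _) hRinv.le
      set a := ‖fderiv ℝ v x‖ with ha_def
      set b := ‖curl v x‖ with hb_def
      have ha : 0 ≤ a := norm_nonneg _
      have hb : 0 ≤ b := norm_nonneg _
      have t1 : |⟪curl φ x, fderiv ℝ v x (curl v x)⟫| ≤ R⁻¹ * CΦ * (a * b) := by
        refine (abs_real_inner_le_norm _ _).trans ?_
        calc ‖curl φ x‖ * ‖fderiv ℝ v x (curl v x)‖ ≤ (R⁻¹ * CΦ) * (a * b) :=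
              mul_le_mul hcφ ((fderiv ℝ v x).le_opNorm _) (norm_nonneg _) (by positivity)
          _ = R⁻¹ * CΦ * (a * b) := rfl
      have t2 : |⟪curl v x, fderiv ℝ φ x (curl v x)⟫| ≤ R⁻¹ * CΦ * (b * b) := by
        refine (abs_real_inner_le_norm _ _).trans ?_
        calc ‖curl v x‖ * ‖fderiv ℝ φ x (curl v x)‖ ≤ b * ((R⁻¹ * CΦ) * b) :=
              mul_le_mul_of_nonneg_left (((fderiv ℝ φ x).le_opNorm _).trans (mul_le_mul_of_nonneg_right hDφ hb)) hb
          _ = R⁻¹ * CΦ * (b * b) := by ring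
      have t3 : |⟪curl v x, fderiv ℝ v x (curl φ x)⟫| ≤ R⁻¹ * CΦ * (a * b) := by
        refine (abs_real_inner_le_norm _ _).trans ?_
        calc ‖curl v x‖ * ‖fderiv ℝ v x (curl φ x)‖ ≤ b * (a * (R⁻¹ * CΦ)) :=
              mul_le_mul_of_nonneg_left (((fderiv ℝ v x).le_opNorm _).trans (mul_le_mul_of_nonneg_left hcφ ha)) hb
          _ = R⁻¹ * CΦ * (a * b) := by ring
      have hsum := (abs_add_le _ _).trans (add_le_add ((abs_add_le _ _).trans (add_le_add t1 t2)) t3)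
      have hab : 2 * (a * b) + b ^ 2 ≤ a ^ 2 + 2 * b ^ 2 := by
        have := two_mul_le_add_sq a b
        linarith only [this]
      calc |⟪curl φ x, fderiv ℝ v x (curl v x)⟫ + ⟪curl v x, fderiv ℝ φ x (curl v x)⟫ + ⟪curl v x, fderiv ℝ v x (curl φ x)⟫|
          ≤ R⁻¹ * CΦ * (a * b) + R⁻¹ * CΦ * (b * b) + R⁻¹ * CΦ * (a * b) := hsum
        _ = R⁻¹ * CΦ * (2 * (a * b) + b ^ 2) := by ring
        _ ≤ R⁻¹ * CΦ * (a ^ 2 + 2 * b ^ 2) := mul_le_mul_of_nonneg_left hab (mul_nonneg hRinv.le hC0)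
        _ = g x / R := by rw [hg, ha_def, hb_def, div_eq_inv_mul]; ring
    refine (abs_integral_le_integral_abs).trans ?_
    have hgi' : Integrable (fun x => g x / R) volume := hgi.div_const R
    calc (∫ x, |⟪curl φ x, fderiv ℝ v x (curl v x)⟫ + ⟪curl v x, fderiv ℝ φ x (curl v x)⟫ + ⟪curl v x, fderiv ℝ v x (curl φ x)⟫|)
        ≤ ∫ x, g x / R := integral_mono_of_nonneg (Eventually.of_forall fun x => abs_nonneg _) hgi'
            (Eventually.of_forall hptw)
      _ = G / R := by rw [integral_div]
  -- bound on `c₁(φ_R)`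
  have hCb : |Cφ| ≤ η / 2 * W + 3 * CΦ ^ 2 * r₁ ^ 3 * v₁ / (2 * η) / R := by
    rw [hCφ]
    set ind : EuclideanSpace ℝ (Fin 3) → ℝ := (closedBall (0 : EuclideanSpace ℝ (Fin 3)) (R * r₁)).indicator fun _ => (1 : ℝ)
      with hind
    have hptw : ∀ x, |∑ i, ⟪fderiv ℝ (curl v) x (EuclideanSpace.basisFun (Fin 3) ℝ i),
        fderiv ℝ (curl φ) x (EuclideanSpace.basisFun (Fin 3) ℝ i)⟫| ≤
        η / 2 * frobeniusNormSq (fderiv ℝ (curl v) x) + 1 / (2 * η) * (3 * (R⁻¹ * (R⁻¹ * CΦ)) ^ 2 * ind x) := by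
      intro x
      have hη' : 0 ≤ 1 / (2 * η) := by rw [one_div]; exact (inv_pos.2 (by linarith only [hη])).le
      refine (sum_inner_le_frobeniusNormSq (fderiv ℝ (curl v) x) (fderiv ℝ (curl φ) x) hη).trans
        (add_le_add le_rfl (mul_le_mul_of_nonneg_left ?_ hη'))
      refine (BradshawTsai2017.frobeniusNormSq_le_three_mul_norm_sq _).trans ?_
      rw [hφdef, fderiv_curl_rescale hΦ2, norm_smul, norm_smul, Real.norm_eq_abs, abs_of_pos hRinv]
      by_cases hx : x ∈ closedBall (0 : EuclideanSpace ℝ (Fin 3)) (R * r₁)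
      · rw [hind, indicator_of_mem hx, mul_one]
        have h0 : 0 ≤ R⁻¹ * (R⁻¹ * ‖fderiv ℝ (curl Φ) (R⁻¹ • x)‖) :=
          mul_nonneg hRinv.le (mul_nonneg hRinv.le (norm_nonneg _))
        have : R⁻¹ * (R⁻¹ * ‖fderiv ℝ (curl Φ) (R⁻¹ • x)‖) ≤ R⁻¹ * (R⁻¹ * CΦ) :=
          mul_le_mul_of_nonneg_left (mul_le_mul_of_nonneg_left (hDcurlb _) hRinv.le) hRinv.le
        exact mul_le_mul_of_nonneg_left (pow_le_pow_left₀ h0 this 2) (by norm_num)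
      · have hy : R⁻¹ • x ∉ tsupport (fderiv ℝ (curl Φ)) := by
          intro hmem
          have := hsupp hmem
          rw [mem_closedBall, dist_zero_right, norm_smul, Real.norm_eq_abs, abs_of_pos hRinv] at this
          apply hx
          rw [mem_closedBall, dist_zero_right]
          have := mul_le_mul_of_nonneg_left this hRpos.le
          rwa [← mul_assoc, mul_inv_cancel₀ hRpos.ne', one_mul] at this
        have hind0 : ind x = 0 := by rw [hind, indicator_of_notMem hx]
        rw [image_eq_zero_of_notMem_tsupport hy, norm_zero, mul_zero, mul_zero, hind0, mul_zero]
        norm_num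
    have hvol : (volume (closedBall (0 : EuclideanSpace ℝ (Fin 3)) (R * r₁))).toReal = (R * r₁) ^ 3 * v₁ := by
      rw [Measure.addHaar_closedBall volume (0 : EuclideanSpace ℝ (Fin 3)) (by positivity : (0 : ℝ) ≤ R * r₁),
        finrank_euclideanSpace, Fintype.card_fin, ENNReal.toReal_mul, ENNReal.toReal_ofReal (by positivity)]
    have hind_int : Integrable ind volume := by
      rw [hind, integrable_indicator_iff measurableSet_closedBall]
      exact integrableOn_const measure_closedBall_lt_top.ne
    have hmaj_int : Integrable (fun x => η / 2 * frobeniusNormSq (fderiv ℝ (curl v) x) +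
        1 / (2 * η) * (3 * (R⁻¹ * (R⁻¹ * CΦ)) ^ 2 * ind x)) volume :=
      (IW.const_mul _).add ((hind_int.const_mul _).const_mul _)
    refine (abs_integral_le_integral_abs).trans ((integral_mono_of_nonneg (Eventually.of_forall fun x => abs_nonneg _)
      hmaj_int (Eventually.of_forall hptw)).trans (le_of_eq ?_))
    rw [integral_add (IW.const_mul _) ((hind_int.const_mul _).const_mul _), integral_const_mul, integral_const_mul,
      integral_const_mul, hind, integral_indicator measurableSet_closedBall, setIntegral_const, smul_eq_mul, mul_one,
      Measure.real, hvol, ← hW]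
    field_simp
  -- assemble
  have hJterm : |S| * |Jφ| ≤ |S| * G / R := by
    have := mul_le_mul_of_nonneg_left hJ (abs_nonneg S)
    have e : |S| * (G / R) = |S| * G / R := by ring
    linarith only [this, e]
  have hKMZ : 0 ≤ K ^ 2 * M ^ 2 * Z := by positivity
  have hCterm : K ^ 2 * M ^ 2 * Z * |Cφ| ≤
      K ^ 2 * M ^ 2 * Z * (η / 2 * W) + K ^ 2 * M ^ 2 * Z * (3 * CΦ ^ 2 * r₁ ^ 3 * v₁ / (2 * η)) / R := by
    have := mul_le_mul_of_nonneg_left hCb hKMZ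
    have e : K ^ 2 * M ^ 2 * Z * (η / 2 * W + 3 * CΦ ^ 2 * r₁ ^ 3 * v₁ / (2 * η) / R) =
        K ^ 2 * M ^ 2 * Z * (η / 2 * W) + K ^ 2 * M ^ 2 * Z * (3 * CΦ ^ 2 * r₁ ^ 3 * v₁ / (2 * η)) / R := by ring
    linarith only [this, e]
  -- the three small terms
  have hP1 : 0 ≤ K ^ 2 * Z * W * CΦ := by positivity
  have hε1 : K ^ 2 * Z * W * (δ * CΦ) ≤ ε * D₀ / 4 := by
    have e : K ^ 2 * Z * W * (δ * CΦ) = (K ^ 2 * Z * W * CΦ) * (ε * D₀) / (4 * (K ^ 2 * Z * W * CΦ + 1)) := by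
      rw [hδdef]; ring
    rw [e, div_le_div_iff₀ (by positivity) (by positivity)]
    have hεD : 0 ≤ ε * D₀ := (mul_pos hε hD₀).le
    have hX : 0 ≤ (K ^ 2 * Z * W * CΦ) * (ε * D₀) := mul_nonneg hP1 hεD
    nlinarith only [hX, hεD, hP1]
  have hP2 : 0 ≤ K ^ 2 * M ^ 2 * Z * W := by positivity
  have hε2 : K ^ 2 * M ^ 2 * Z * (η / 2 * W) ≤ ε * D₀ / 4 := by
    have e : K ^ 2 * M ^ 2 * Z * (η / 2 * W) = (K ^ 2 * M ^ 2 * Z * W) * (ε * D₀) / (8 * (K ^ 2 * M ^ 2 * Z * W + 1)) := by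
      rw [hηdef]; field_simp; ring
    rw [e, div_le_div_iff₀ (by positivity) (by positivity)]
    have hεD : 0 ≤ ε * D₀ := (mul_pos hε hD₀).le
    have hX : 0 ≤ (K ^ 2 * M ^ 2 * Z * W) * (ε * D₀) := mul_nonneg hP2 hεD
    nlinarith only [hX, hεD, hP2]
  have hε3 : |S| * G / R + K ^ 2 * M ^ 2 * Z * (3 * CΦ ^ 2 * r₁ ^ 3 * v₁ / (2 * η)) / R ≤ ε * D₀ / 4 := by
    rw [← add_div, ← hT, div_le_iff₀ hRpos]
    have h := hRT
    rw [div_le_iff₀ (by positivity)] at h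
    linarith only [h]
  have hfin : D₀ * |Aφ| ≤ 3 * (ε * D₀ / 4) := by
    linarith only [hkkt, hJterm, hCterm, hε1, hε2, hε3]
  rw [dist_zero_right, Real.norm_eq_abs]
  have hA34 : |Aφ| ≤ 3 * ε / 4 := by
    have h' : D₀ * |Aφ| ≤ D₀ * (3 * ε / 4) := by linarith only [hfin]
    exact le_of_mul_le_mul_left h' hD₀
  show |Aφ| < ε
  linarith only [hA34, hε]

end ExtremiserLiouville

end Summit.NavierStokesRegularity.NavierStokesRegularity.Theorems

end
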